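import Literature.MathematicalPhysics.QuantumFieldTheory.Balaban1983to89.B7Prop1Local

/-!
# `Balaban1983to89.B7Carve47SectsACHyp` — [Balaban1985Averaging] pp. 17–35 (Introduction and Sects. A–C: the averaging
# operations (1)–(15), norms and matrix functions (16)–(41), the block averages and Propositions 1–2 (42)–(54), the other
# averaging operations and the gauge fixing (55)–(108), and the start of Sect. D (109)–(120)): P6 CARVING-FAN BLOCK 47 — the
# block's residual printed sentences (here: TYPED AND PROVED) and ONE hypothesis bundle `Hyp` of the range's printed statements
# BY NAME, keyed to the consumer (`stmt-QuantumFields-20542`, K1⁷ `StabilityBAtRecordR13SepCoPH`; also-feeds 20544)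

statement-level skeleton of published theorems with citation tags; proofs where landed; nothing here is a claim about the
Yang–Mills mass gap

T. Bałaban, *Averaging operations for lattice gauge theories*, Commun. Math. Phys. **98** (1985) 17–51,
doi:10.1007/bf01211042 `[Balaban1985Averaging]` (cell paper "B7" = «[7]» of [Balaban1987RG1]; journal page = PDF page + 16).
STATUS: published, refereed.  PDF held: `paper:balaban1985-cmp98-averaging`; pp. 17–35 [PDF 1–19] read by this seat on the text
layer (`p0001.txt` … `p0019.txt`, line locators `pNNNN.txt:Ln` below) and p. 25 AS AN IMAGE (render
`run/shared/lean/pub/pub-balaban/b2b-balaban-ref1/pages/1985-cmp98-averaging/1985-cmp98-averaging-p009-x2.png`, 2026-08-28); the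
displays of pp. 17–35 also through the verbatim quotations of record (read as images by their typing seats) in `B7`,
`B7Prop1Explicit`, `B7Prop1Local`, `B7Eq31BCH`, `B7Eq38Remainder`, `B7Eq61Linearization`, `B7Eq84Concrete`, `B7Eq99Concrete`.
References of [B7] used here: [1] = Bałaban CMP 85 (1982), [2] = [Balaban1984PropagatorsI] (B5), [7] = V. S. Varadarajan,
*Lie groups, Lie algebras, and their representations* [Varadarajan1984].

CITATION HEADER (lean-in-tree rule).  Cell `lit-balaban` (HOME `run/shared/lean/pub/lit-balaban/`), P6 CARVING FAN
(D-0154 (3b)), reserve block 47 of `carve/BLOCKS-41-48.md` (lead g31, READY 2026-08-28T08:15Z, RULING #10) = `carve/CARVE-LIST.md`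
§ Block 47, claimed by seat `carve-10` g4 (`carve/STATUS.md` CLAIM 08:24:51Z): «[B7] Intro + Sects. A–C: averaging operations,
norms, compositions, Props 1–2 p. 26, other averaging operations (1)–(120); 53 SKELETON rows (proved-existing 34, typed-existing 16,
proved 3); KEY stmt-QuantumFields-20542, also-feeds 20544; target this file».  Filed `--supports stmt-QuantumFields-20542`.
RULES (`carve/CARVE-RULES.md` §2; RULING #9 (2)): IN TREE = CITE, NEVER RESTATE; residual printed statements typed (here every
residual is PROVED, so no `def … : Prop` hypothesis is minted); ONE bundle `Hyp`; no `instance`, no `notation`, 0 `sorry`.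

## WHAT THE BLOCK'S PAGES PRINT AND WHERE THE TREE HOLDS IT (cite table — every SKELETON row of the block is IN TREE;
## nothing in this table is restated below)
Numbered displays (the 53 rows of `carve/CARVE-LIST.md` § Block 47):
* (1)–(5) pp. 17–18 (lattices `Ω^{(j)}`, blocks `B^k(y)` (2)–(3), bonds and plaquettes (4)–(5)): `Setup` (`block`, `PBond`,
  `Averaging`, `IsRT`), `B8ConstraintBonds.IsLevel`, `B7Eq2BlocksZd`, `B7SectAStatements.blockOfIter/blockJ/blockJSet`,
  `B7Prop1Explicit.boxVec` (B(y) = y + [0, L)^d).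
* (6)–(9) p. 18 (gauge fields, `U(Γ)` along contours, `U(∂p)`, gauge transformations (8)): `Setup` (`GaugeField`, `GaugeTransf`,
  `GaugeField.plaqHol`), `B7Prop1Explicit.hol` (9), `gaugeAct` (8), `hol_gaugeAct` («`V^u(Γ) = u(Γ₋)V(Γ)u(Γ₊)⁻¹`»), `plaqWord`.
* (10)–(13) p. 19 (renormalization transformations, gauge covariance (11), (12)–(13)): `Setup.fieldMeasure`, `Setup.IsRT`,
  `GaugeField.GaugeInvariant`, `B9Eq332QprimeTowerGaugeCovariance.*`.
* (14) p. 19 and p. 20 (p0004.txt:L1–3) («expanding the logarithm … we get the expression (14) as a linear term in the expansion»):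
  `Setup.LinAveraging`, `B7Eq14LinearAverage` (the sentence as a kernel theorem: the derivative of `log Ū_c` along `e^{tA}`).
* (15) = (42), (43) pp. 19–20, 23–24 (THE block average): `B7Prop1Explicit.Wcx`, `Xavg`, `bavg` (42), `cplaq`;
  `B7Prop2Explicit.avgIter` (43), `rescale`; `B7BlockAvgLog.barAvg`; on the torus `BlockAveragingHaarAC`.
* (16)–(20) pp. 20–21 (trace (17), scalar products (18), operator norm (19), inequalities (20)): `MatrixNorms.ntr`, `mInner`-family
  of `B7SectAStatements` (18), `LatticeNorms.volElt`, `B12EdgeTreeLength257L1.dist1` (19), `MatrixNorms.abs_nReTr_le_opNorm` (20)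
  (with `MatrixNorms`' recorded caveat on the last inequality of (20) for the normalized Hilbert–Schmidt norm).
* (21)–(27) pp. 21–22 (the logarithm (21), its spectral form (22)–(23), (24)–(27)): `MatrixLog.mlog`, `hasSum_mlog`, `exp_mlog`,
  `analyticAt_mlog` (p. 21 «both functions are analytic functions of complex matrices X»), `norm_expUnitary_sub_one_le` (24)–(27),
  `B7AvgClosedSpecialUnitarySharp` ((22)–(23) at `SU(N)`).
* (28)–(29) p. 22 (BCH, «see [7], Sect. 2.15», «the series is convergent in a neighborhood of 0: |X|, |Y| ≤ c₀ for some positive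
  c₀» p0006.txt:L17): `Literature.Analysis.Calculus.BCH.hasSum_dynkinTerm` (`BCHDynkin`: Dynkin's formula PROVED for
  `‖X‖ + ‖Y‖ ≤ 1/5`), `BCHDynkinLowOrder`, `B7Eq29Dynkin` — this resolves the carve list's «cite UNRESOLVED» for row B7.Eq28.
* (30)–(31) p. 22 («where c₁ is a sufficiently small positive constant, c₁ ≤ c₀» p0006.txt:L23): `B7Eq31BCH.eq31_printed`,
  `eq30_printed` (`c₁ = 1/10`, `O(1) = 5` admissible; `1/10 + 1/10 ≤ 1/5` is inside `BCHDynkin`'s domain, so «c₁ ≤ c₀» holds for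
  the certified pair).
* (32)–(35) pp. 22–23 («see [7, Theorem 2.14.3]» p0006.txt:L29–31; «The function g(z) … is an entire function given by (33)»;
  p0006.txt:L24–27 «f(ad_X) can be defined by the power series expansion»): `Literature.Analysis.Calculus.ExpDifferential.fderiv_exp_apply`,
  `dexp_apply`, `gSer`, `mul_gSer`, `gSer_mul_gInv` ((34)), `B7Eq32ExpDifferential.*`, `B7Eq34Domain`, `B7Eq34EigenvalueGaps`.
* (36)–(41) p. 23 ((38) «for |X|, |Y| sufficiently small, where O(1) is an absolute constant [e.g., we can take O(1) = 24 for
  |X| ≤ 1/20, |Y| ≤ 1/12]» p0007.txt:L17–18): `B7Eq38Remainder.eq38_printed` (EXACTLY these constants, PROVED), `B7Eq32ExpDifferential`.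
* (44)–(50) pp. 24–25 (hypothesis (44), the local axial gauge, `Δ(p′)` (46), (47)–(50)): `B7Prop1Explicit.axialFn`,
  `hol_axial_treeWord` (existence of `v₀`), `axial_bond_eq`, `axial_bond_bound` (p. 25 «|V₀,b − 1| < |b₋ − y|α₀ ≤ dLα₀»),
  `prop1_explicit`; `B8Lemma1NonAbelian.axial_bond_bound_sharp`; on the torus `B7Eq44TorusAxialGauge.plaqSmall_perCfg`, `axialGaugeT`,
  `B7Eq44TorusAxialGaugeLocal` (the printed LOCAL form); `B7AvgGaugeCovariance`, `B7Prop1Explicit.bavg_gaugeAct` (p0008.txt:L8–12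
  «(\overline{U^u})_c = u(c₋)Ū_c u⁻¹(c₊)», «the property (11) is satisfied»).
* Prop. 1 (51) p. 26 with «The constant C₀ depends on d and c₂′ depends on d and L» (p0010.txt:L5): `B7.Prop1Printed` (leaf),
  `B7Prop1Explicit.prop1Printed_concrete` (PROVED with `C₀ = 14464(d+1)²(d+4)²`, `c₂′ = 1/(512(d+1)(d+4)L²)` — exactly the printed
  dependence), `B7Prop1Local.prop1_local` ∕ `prop1Printed_concrete_local` (PROVED WITH THE PRINTED LOCALITY «(44) for p ⊂ Δ(p′)»;
  p0009.txt:L36–37 «Let us notice that it is a local result; the bound above depends on bounds for V(∂p) − 1 on Δ(p′)»: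
  `B7Prop1Local.cplaq_bavg_congr`); `T3LowerAlongMinimisersSplit.Prop1EmlAt` (the T3-family transcription at given constants).
* (52)–(54), Prop. 2 p. 26 (the induction (53): «for j < k, we can apply Proposition 1 to the configuration Ū^j … Thus the
  inequality (53) is proved for all j ≤ k»; the locality sentence after (54)): `B7.Prop2Printed` (leaf), `B7.step53_alg`,
  `B7.ineq53_induction`, `B7.prop2_bound_lt_two_alpha`, `B7Prop2Explicit.prop2_explicit` ∕ `prop2Printed_concrete` (PROVED),
  `B7Prop1Local.prop2_local` ∕ `prop2Printed_concrete_local` ∕ `prop2Printed_unitaryGroup_local` (PROVED WITH THE PRINTED LOCALITY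
  «it is enough to assume (52) for p ⊂ B^k(x) ∪ B^k(y) ∪ B^k(z) ∪ B^k(w)», `hol_plaqWord_avgIter_congr`),
  `B7Eq47AveragedBondVsStraight.pdev_avgIter_lt_two_mul`, `B7Eq44TorusAxialGauge.plaqSmall_perCfg` ((52) on the torus).
* p. 24 (p0008.txt:L5–6) «this definition is local in the sense that Ū^k_c, c ⊂ Ω^{(k)}, depends only on the bond variables U_b for
  b ⊂ B^k(c₋) ∪ B^k(c₊)»: `B7Prop1Local.bavg_congr`, `avgIter_congr` (PROVED, verbatim).
* (55)–(59) p. 27 (moving frame (55), `R(X)Y = XYX⁻¹` (56), its properties (57), block axial gauge (58), (59)):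
  `T4AdjointCovariance.adAct`, `T4AdjointCovarianceClosedSubgroup.*`, `B7Eq57Adjoint` ((57) incl. the adjointness w.r.t. (17)),
  `B7Eq92Concrete.Rc`, `mgauge` (55), `B7Eq84Concrete.AxialGauge` (58)/(64)/(66)/(67), `B7Eq99Concrete.R0fun`.
* p. 27 bottom – p. 28 (the recall of [1]∕[2] «Such a transformation does not change the average given by (1.11) in [2]»; the
  unnumbered displays `(Q₀A^λ)(c) = …`, `Σ_{x′∈B(c₊)} … = Σ … R(V₀(Γ_{c,x}∪(−c)))R(V₀(c))(R_{0,c₊}λ)(x′)`; «approximately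
  preserved»; `Q₀`, `Q′₀`): `B7Eq61Linearization.Q0`, `Qp0`, `Q0_gauge` (the p. 28 display EXACTLY), `farTerm_eq_loop`,
  `Q0_gauge_of_Qp0_eq_zero`, `norm_Q0_gauge_sub_le` («approximately» quantified), `Qav_gauge_of_Qp_eq_zero` (the [2] sentence) — PROVED.
* (60)–(63) pp. 27–28 and «these conditions are approximations for λ small to the conditions (61)», «Thus the gauge
  transformation v is determined uniquely by the gauge conditions (58) and conditions (61). It is a function of the gauge
  transformed configuration V₁» (p0012.txt:L33–34): `B7Eq99Concrete.R0avg_of_60`, `R0avg`, `B7Eq78Linearization` (the linear part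
  of (61)/(78)), `B7Eq84Concrete.gaugeFixing_exists`, `gaugeFixing_unique` (k = 1 included) — PROVED.
* (64)–(77) pp. 29–30 ((69) «it follows easily»; «Taking (77) for j = k − 1, we may determine the gauge transformation u uniquely,
  given values u(y) at points y of the lattice Ω^{(k)}» p0014.txt:L4–6): `B7Eq84Concrete.AxialGauge`, `eq72_iff_eq76`, `telHol`,
  `telTw`, `eq77`, `gauge_formula`; `B7Eq92Concrete.tildIter` ((65)/(68)), `tildIter_succ`, `tildIter_mul` ((69)) — PROVED.
* (78)–(88) pp. 30–31 («These conditions are straightforward generalizations of the conditions (61)»; «Thus the gauge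
  transformation is uniquely determined by all the conditions and is given by the formulas (77) for j = k − 1 and by (87)»
  p0015.txt:L7–8): `B7Eq99Concrete.Sexp`, `R0avg` (78), `B7Eq84Concrete.uavg` (79)/(80), `eq84`, `eq81_iff_eq87`, `eq88`,
  `gaugeFixing_exists`, `gaugeFixing_unique`, `eq88_glev`; `B7Eq78Linearization.Rbar`; `B7Eq167Flat.Cond166` ∕ `Cond167`,
  `B7Prop8to10Local.Cond166On` (the CONDITIONS (166)–(167) of Sect. E on the averages (79)–(80) and the rotations (58)/(78) —
  predicates consumed as binders by Sect. E statements (block 48), cited, not bundled here) — PROVED where claims.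
* (89)–(100) pp. 31–32 (the new averaging operations (89)–(91); «the following fundamental fact: the new kth order averaging
  operation defined by the last expression in (88) is a composition of k averaging operations defined by (63)» = (92); the
  inductive hypothesis (97) «We have proved it for j = 1, 2» p0016.txt:L16; (99) «is proved by induction»):
  `B7Eq92Concrete.dbavgCov` (89), `dbavgCovIter` (90)/(91), `vcov` (97), `vcov_succ`, `tildIter_eq_mgauge` ((92) PROPER),
  `B7Eq99Concrete.wrec`, `wrec_eq_vcov` ((99)/(100) for every j), `eq88_of_87`; `B7Eq84Concrete.avgIter_glev` — PROVED.
* p. 31 (p0015.txt:L28–30) «these averages have the same locality properties as the averages Ū^k, namely (Ũ′_k)_c, c ⊂ Ω^{(k)}, depends on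
  the variables U_b for b ⊂ B^k(c₋) ∪ B^k(c₊)» and p. 34 (p0018.txt:L2–3) «involves only the gauge fields U_{1,b}, U_{0,b} at bonds
  b ⊂ B^k(c₋)∪B^k(c₊)»: `B7LocalityGeneral.tild_congr`, `dbavgCov_congr`, `logCovIter_congr` (general background, all levels),
  `B7Prop5Flat.dbavg_congr` (flat), `B7Prop5GeneralLevels.dbavgCov_congr` — PROVED.
* (101)–(108) p. 33 («Thus we obtain the equality (104)»): `B7Eq106Concrete.lvTw`, `eq104`, `eq105`, `eq106`, `eq107`, `eq108` — PROVED.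
* (109)–(120) pp. 34–35 ((111) «+ O((|A|(Γ))²)», (116) «Applying the results of Sect. A, more exactly (38)», the p. 35 identities
  «R(e^{iY_x}) = e^{i ad_{Y_x}}» and «g⁻¹(−i ad_{Y_x})e^{i ad_{Y_x}} = g⁻¹(i ad_{Y_x}). The last follows from the corresponding identity
  for functions of a complex variable: g⁻¹(−z)e^z = g⁻¹(z)» p0019.txt:L21–23, and the two unnumbered displays before (120)):
  `B7Prop3Flat.expCfg` (109), `B7Prop3GeneralRotated.hasDerivAt_mlog_tHol_expCfg` ((110)–(111)), `B7Eq112General.eq111_general`,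
  `eq112_general`, `eq118_general`, `B7Prop3GeneralLinear.linQcov_eq_of_tild` ((120), frame part), `B7Prop3Flat` (the flat case
  (110)–(124)); the identities: `Literature.Analysis.Calculus.ExpDifferential.exp_ad_apply` («Ad(e^X) = e^{ad X}») and
  `exp_mul_gSer` (`e^T g(T) = g(−T)`, the Banach-algebra form of `g⁻¹(−z)e^z = g⁻¹(z)`) — ingredients PROVED; the standing
  assumption p. 34 (p0018.txt:L10–11) «We assume that α₀ is so small that the Propositions 1 and 2 hold, i.e., α₀ ≤ c₂» is the field
  `Hyp.α₀_le_c₂` below; the announced analyticity «for α₀, α₁ sufficiently small» is Proposition 3 p. 36 (block 48;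
  `B7Prop3Flat.prop3_flat_analyticAt` with `c₃ = 1/(128(d+1)L)`, `B7Prop3GeneralAnalytic`).
* p. 20, Sect. A opening (the group `G ⊂ U(N)`, its Lie algebra, «The unitary group U(N) can be obtained by an application of the
  exponential mapping to the algebra of hermitian matrices» p0004.txt:L33–35, «The group G is obtained by applying the function
  e^{iA} to A ∈ g»): `Setup.GaugeGroup` (DIVERGENCE F4: the matrix realisation, the Lie algebra and `Gᶜ` are type parameters),
  `MatrixLog.exists_isHermitian_exp_eq` (every unitary matrix is `e^{iA}`, `A` hermitian — PROVED), `B7AvgClosedSpecialUnitarySharp`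
  (the `G`-valuedness of the averages this sentence tacitly needs, at `SU(N)`).

## WHAT THIS FILE ADDS
§1 TWO RESIDUAL PRINTED SENTENCES with no declaration of record (searched 2026-08-28: `rg` over `Balaban1983to89/*.lean`,
`Setup.lean`, `Matrix*.lean` for «complexif», «basis», «uniquely», `axialFn`; hits only in docstrings), TYPED AND PROVED (no
hypothesis minted):
* p. 20 (p0004.txt:L27–31) «we take a basis {t_a} of the algebra g, then all elements A ∈ g can be written as linear
  combinations A = Σ_a A_a t_a, … A_a ∈ ℝ, and we form a complexification gᶜ taking A_a as arbitrary complex numbers, A_a ∈ ℂ.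
  It is easy to see that this complexification is independent of any particular basis {t_a} chosen in the above definition.»
  — `span_complex_range_basis_eq` (the ℂ-span of any ℝ-basis of a real subspace `g` of a complex space is the ℂ-span of `g`),
  `complexification_basisFree` (THE SENTENCE: two bases give the same `gᶜ`); and p. 20 (p0004.txt:L22–25) «The
  complexification of the algebra of hermitian matrices is the algebra of all complex N×N matrices» — `span_complex_selfAdjoint_eq_top`
  (any complex star module: `x = Re x + i Im x`), `span_complex_isHermitian_eq_top` (matrices, verbatim).
* p. 24 (p0008.txt:L24–27) «Such a gauge transformation can be easily found because V₀(Γ_{y,x}) = V^{v₀}(Γ_{y,x})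
  = v₀(y)V(Γ_{y,x})v₀⁻¹(x) = 1 implies v₀(x) = v₀(y)V(Γ_{y,x}); thus v₀ is determined uniquely if v₀(y) is given.» — on the tree's
  carriers (`B7Prop1Explicit.hol`, `gaugeAct`, `treeWord`, `axialFn`; the tree records EXISTENCE, `hol_axial_treeWord`, with
  `v₀(y) = 1`): `hol_gaugeAct_treeWord` (the displayed computation), `gauge_eq_of_axial` («implies v₀(x) = v₀(y)V(Γ_{y,x})»),
  `axial_iff` (the axial conditions ⇔ this formula), `axialGauge_unique` («determined uniquely if v₀(y) is given»).
§2 THE BUNDLE.  `Hyp L C₀ c₂' α₀ fam₁ fam₂` — the range's printed STATEMENTS as hypotheses BY NAME over the tree's abstract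
carriers `B7.OneStep` ∕ `B7.KStep`: Proposition 1 (`B7.Prop1Printed`), «positive constants C₀, c₂′», Proposition 2 at these
constants (`B7.Prop2Printed C₀ c₂'`), and the standing smallness of p. 34 carried into Sect. D («α₀ ≤ c₂ = min{1/(3C₀), ½c₂′}»,
(54) p. 26 with p. 34, p0018.txt:L10–11).  Everything else in the range is a theorem or a definition of the tree (table above) and enters
nothing.  Bookkeeping theorems: `Hyp.C₀_mul_α₀_le`, `Hyp.two_mul_α₀_le` (the two clauses of `c₂`), `Hyp.bound54_lt` («< 2α₀», the
last inequality of (54), via `B7.prop2_bound_lt_two_alpha`), `Hyp.avgDevK_lt` ∕ `Hyp.avgDevK_lt_two_mul` ((54) at the standing α₀),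
`Hyp.rescales_by_L_sq` (p. 26 «Each averaging operation rescales a bound on plaquette variables approximately by the factor L²» made
exact: for every ε > 0, below a threshold, `|V̄(∂p′) − 1| < (1 + ε)L²α`), and THE DISCHARGE `Hyp.concreteLocal` ∕ `Hyp.unitaryGroup`:
for the tree's concrete local families on `ℤ^d` (`B7Prop1Local.concreteOneStepLocal`, `concreteKStepLocal`, any `AvgClosed` gauge
group, in particular `G = U(N) ⊂ M_N(ℂ)`) the WHOLE bundle is a kernel theorem at `C₀ = C0 d`, `c₂′ = c2' d L`, every `0 < α₀ ≤ c₂`.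

## HONEST SCOPE
Nothing of [B7] is proved here beyond linear algebra, group algebra and real arithmetic on top of the tree's theorems; the
bundle is an interface over abstract carriers (for abstract families `fam₁`, `fam₂` its fields are hypotheses), discharged in
the kernel for the tree's concrete `ℤ^d` models by the cited theorems; the complexification lemma is stated for a real subspace of
an arbitrary complex vector space (print: a Lie subalgebra of the hermitian `N×N` matrices — a special case), the uniqueness
lemma for gauge fields with values in an arbitrary group on `ℤ^d` (print: `G ⊂ U(N)`, a neighbourhood of `y`; the algebra is
pointwise, so the restriction to a neighbourhood changes nothing); no summit statement is proved by this seat; count-neutral;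
nothing continuum ∕ ℝ⁴ ∕ OS ∕ mass-gap ∕ Clay.  No `sorry`, no `instance`, no `notation`; net new unproved facts: 0.
-/

noncomputable section

open scoped BigOperators

namespace Literature.MathematicalPhysics.QuantumFieldTheory.Balaban1983to89.B7Carve47SectsACHyp

open B7Prop1Explicit (e hol disp treeWord gaugeAct axialFn disp_treeWord hol_gaugeAct U1)
open B7Prop2Explicit (C0 c2' C0_pos c2'_pos AvgClosed unitaryUnits avgClosed_unitaryUnits)
open B7Prop1Local (concreteOneStepLocal concreteKStepLocal prop1Printed_concrete_local prop2Printed_concrete_local)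

/-! ## §1a  p. 20: the complexification `gᶜ` does not depend on the basis `{t_a}` (PROVED) -/

section Complexification

variable {E : Type*} [AddCommGroup E] [Module ℂ E]

/-- p. 20 (p0004.txt:L27–31): «we take a basis `{t_a}` of the algebra `g`, then all elements `A ∈ g` can be written as linear combinations
`A = Σ_a A_a t_a`, where `A_a` are arbitrary real numbers, `A_a ∈ ℝ`, and we form a complexification `gᶜ` taking `A_a` as arbitrary
complex numbers, `A_a ∈ ℂ`.»  For a real subspace `g` of a complex vector space `E` (print: `g ⊂` hermitian `N × N` matrices
`⊂ M_N(ℂ)`) and ANY `ℝ`-basis `b` of `g`, the set `{Σ_a A_a t_a : A_a ∈ ℂ}` = the `ℂ`-span of the basis vectors is the `ℂ`-span of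
`g` itself. [cite: Balaban1985Averaging, p.20] -/
theorem span_complex_range_basis_eq {ι : Type*} (g : Submodule ℝ E) (b : Module.Basis ι ℝ g) :
    Submodule.span ℂ (Set.range fun i => ((b i : g) : E)) = Submodule.span ℂ (g : Set E) := by
  apply le_antisymm
  · exact Submodule.span_mono (Set.range_subset_iff.2 fun i => (b i).2)
  · refine Submodule.span_le.2 fun x hx => ?_
    have hrepr : ((Finsupp.linearCombination ℝ (fun i => b i) (b.repr ⟨x, hx⟩) : g) : E) = x := by
      rw [Module.Basis.linearCombination_repr]
    rw [← hrepr, Finsupp.linearCombination_apply, Finsupp.sum, Submodule.coe_sum]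
    refine Submodule.sum_mem _ fun i _ => ?_
    rw [Submodule.coe_smul, ← Complex.coe_smul]
    exact Submodule.smul_mem _ _ (Submodule.subset_span ⟨i, rfl⟩)

/-- **p. 20 (p0004.txt:L30–31), AS PRINTED**: «It is easy to see that this complexification is independent of any particular basis `{t_a}`
chosen in the above definition.» — two `ℝ`-bases of `g` span the same complex subspace `gᶜ`. (Hence also p. 20, p0004.txt:L31–33: «a
notion of analyticity is well defined and means analyticity with respect to complex variables `A_a`» — the coordinates w.r.t. two
bases differ by an invertible complex-linear map.) [cite: Balaban1985Averaging, p.20] -/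
theorem complexification_basisFree {ι ι' : Type*} (g : Submodule ℝ E) (b : Module.Basis ι ℝ g) (b' : Module.Basis ι' ℝ g) :
    Submodule.span ℂ (Set.range fun i => ((b i : g) : E)) = Submodule.span ℂ (Set.range fun i => ((b' i : g) : E)) := by
  rw [span_complex_range_basis_eq g b, span_complex_range_basis_eq g b']

/-- p. 20 (p0004.txt:L22–25): «The complexification of the algebra of hermitian matrices is the algebra of all complex `N×N` matrices» —
for any complex star module `A` (matrices: `star = ᴴ`), the complex span of the self-adjoint elements is everything, because
`x = Re x + i·Im x` with `Re x = ½(x + x*)`, `Im x = (1/2i)(x − x*)` self-adjoint. [cite: Balaban1985Averaging, p.20] -/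
theorem span_complex_selfAdjoint_eq_top (A : Type*) [AddCommGroup A] [Module ℂ A] [StarAddMonoid A] [StarModule ℂ A] :
    Submodule.span ℂ (selfAdjoint A : Set A) = ⊤ := by
  refine eq_top_iff.2 fun x _ => ?_
  rw [← realPart_add_I_smul_imaginaryPart x]
  exact add_mem (Submodule.subset_span (realPart x).2)
    (Submodule.smul_mem _ _ (Submodule.subset_span (imaginaryPart x).2))

/-- p. 20 (p0004.txt:L22–25), verbatim for matrices: the complex span of the hermitian `n × n` matrices is all of `M_n(ℂ)` (and so, p. 20,
«the complexification of `U(N)` is the general linear complex group `GL(ℂ, N)`» in print's sense `Gᶜ = e^{i gᶜ}`-generated).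
[cite: Balaban1985Averaging, p.20] -/
theorem span_complex_isHermitian_eq_top (n : Type*) [Fintype n] [DecidableEq n] :
    Submodule.span ℂ {X : Matrix n n ℂ | X.IsHermitian} = ⊤ := by
  have h : {X : Matrix n n ℂ | X.IsHermitian} = (selfAdjoint (Matrix n n ℂ) : Set (Matrix n n ℂ)) := by
    ext X
    simp [Matrix.IsHermitian, selfAdjoint.mem_iff, Matrix.star_eq_conjTranspose]
  rw [h]
  exact span_complex_selfAdjoint_eq_top (Matrix n n ℂ)

end Complexification

/-! ## §1b  p. 24: the axial gauge `v₀` is determined by `v₀(y)` (PROVED) -/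

section AxialGauge

variable {d : ℕ} {G : Type*} [Group G]

/-- p. 24 (p0008.txt:L24–26), the displayed computation: «`V₀(Γ_{y,x}) = V^{v₀}(Γ_{y,x}) = v₀(y)V(Γ_{y,x})v₀⁻¹(x)`» — (8) along the tree
contour `Γ_{y,x}` (`treeWord (x − y)`, from `y` to `x`). [cite: Balaban1985Averaging, p.24, (8) p.18] -/
theorem hol_gaugeAct_treeWord (v : B7Prop1Explicit.Site d → G) (V : B7Prop1Explicit.Site d → Fin d → G) (y x : B7Prop1Explicit.Site d) :
    hol (gaugeAct v V) y (treeWord (x - y)) = v y * hol V y (treeWord (x - y)) * (v x)⁻¹ := by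
  rw [hol_gaugeAct, disp_treeWord, add_sub_cancel]

/-- p. 24 (p0008.txt:L26): «… `= 1` implies `v₀(x) = v₀(y)V(Γ_{y,x})`» — any gauge transformation `v` whose transform `V^v` satisfies the
axial conditions `V^v(Γ_{y,x}) = 1` is `v(x) = v(y)·V(Γ_{y,x})` (`= v(y)·axialFn V y x`). [cite: Balaban1985Averaging, p.24] -/
theorem gauge_eq_of_axial {v : B7Prop1Explicit.Site d → G} {V : B7Prop1Explicit.Site d → Fin d → G} {y : B7Prop1Explicit.Site d}
    (h : ∀ x, hol (gaugeAct v V) y (treeWord (x - y)) = 1) (x : B7Prop1Explicit.Site d) : v x = v y * axialFn V y x := by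
  have hx := h x
  rw [hol_gaugeAct_treeWord, mul_inv_eq_one] at hx
  exact hx.symm

/-- p. 24: the axial conditions `V^v(Γ_{y,x}) = 1` for all `x` hold IFF `v(x) = v(y)V(Γ_{y,x})` for all `x` («Such a gauge
transformation can be easily found because …»: the converse direction is the computation (8); the tree's `hol_axial_treeWord` is
the case `v(y) = 1`). [cite: Balaban1985Averaging, p.24] -/
theorem axial_iff (v : B7Prop1Explicit.Site d → G) (V : B7Prop1Explicit.Site d → Fin d → G) (y : B7Prop1Explicit.Site d) :
    (∀ x, hol (gaugeAct v V) y (treeWord (x - y)) = 1) ↔ ∀ x, v x = v y * axialFn V y x := by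
  refine ⟨fun h x => gauge_eq_of_axial h x, fun h x => ?_⟩
  rw [hol_gaugeAct_treeWord, h x]
  simp [axialFn]

/-- **p. 24 (p0008.txt:L26–27), AS PRINTED**: «thus `v₀` is determined uniquely if `v₀(y)` is given» — two gauge transformations putting `V`
in the axial gauge based at `y` and agreeing at `y` are equal. [cite: Balaban1985Averaging, p.24] -/
theorem axialGauge_unique {v v' : B7Prop1Explicit.Site d → G} {V : B7Prop1Explicit.Site d → Fin d → G} {y : B7Prop1Explicit.Site d}
    (h : ∀ x, hol (gaugeAct v V) y (treeWord (x - y)) = 1) (h' : ∀ x, hol (gaugeAct v' V) y (treeWord (x - y)) = 1)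
    (hy : v y = v' y) : v = v' := by
  funext x
  rw [gauge_eq_of_axial h x, gauge_eq_of_axial h' x, hy]

end AxialGauge

/-! ## §2  The bundle: the printed statements of pp. 17–35 as hypotheses, by name -/

/-- **THE BLOCK-47 BUNDLE** — the printed STATEMENTS of [B7] pp. 17–35 in hypothesis form, BY NAME, over the tree's abstract
carriers (`B7.OneStep`: one averaging step on a big plaquette `p′` with its `Δ(p′)`; `B7.KStep`: the `k`-fold average), for a
block length `L`, constants `C₀, c₂′` and the standing smallness parameter `α₀` of Sect. D:
* `prop1` — PROPOSITION 1 (51) p. 26: `B7.Prop1Printed` («There exist positive constants C₀, c₂′ such that … |V̄(∂p′) − 1| <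
  L²α₀ + C₀(L²α₀)²»; discharged for the concrete `ℤ^d` averages by `B7Prop1Explicit.prop1Printed_concrete` and, with the printed
  locality, `B7Prop1Local.prop1Printed_concrete_local`);
* `C₀_pos`, `c₂'_pos` — «positive constants C₀, c₂′» (p. 26), the constants fed to Proposition 2 (print: «C₀, c₂′ = the constants
  of Prop. 1»; the leaf `B7.Prop1Printed` hides its witnesses existentially, the concrete discharges use the same witnesses
  `B7Prop2Explicit.C0 d`, `c2' d L` for both — `Hyp.concreteLocal`);
* `prop2` — PROPOSITION 2 (54) p. 26 at these constants: `B7.Prop2Printed C₀ c₂'` (discharged by `B7Prop2Explicit.prop2Printed_concrete`,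
  `B7Prop1Local.prop2Printed_concrete_local`, `…_unitaryGroup_local`);
* `α₀_pos`, `α₀_le_c₂` — p. 34 (p0018.txt:L10–11) «We assume that α₀ is so small that the Propositions 1 and 2 hold, i.e., α₀ ≤ c₂», with
  `c₂ = min{1/(3C₀), ½c₂′}` of (54) p. 26 (the standing smallness under which Sect. D — block 48 — works).
The conditions (58)/(64)–(67), (79)–(81), (166)–(167) (`B7Eq84Concrete.AxialGauge`, `B7Eq167Flat.Cond166`, `Cond167`,
`B7Prop8to10Local.Cond166On`) are PREDICATES on gauge data, consumed as binders by the statements that need them; the T3-family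
transcription `T3LowerAlongMinimisersSplit.Prop1EmlAt L C₀ c₂'` of Proposition 1 lives on the T3 carriers and is cited, not
re-bundled.  Everything else printed on pp. 17–35 is a definition or a theorem of the tree (module docstring) and enters nothing.
[cite: Balaban1985Averaging, Prop. 1 (51) p.26, Prop. 2 (52)–(54) p.26, p.34] -/
structure Hyp {I J : Type} (L : ℕ) (C₀ c₂' α₀ : ℝ) (fam₁ : I → B7.OneStep) (fam₂ : J → B7.KStep) : Prop where
  prop1 : B7.Prop1Printed (L : ℝ) fam₁
  C₀_pos : 0 < C₀
  c₂'_pos : 0 < c₂'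
  prop2 : B7.Prop2Printed C₀ c₂' fam₂
  α₀_pos : 0 < α₀
  α₀_le_c₂ : α₀ ≤ min (1 / (3 * C₀)) (c₂' / 2)

section Consequences

variable {I J : Type} {L : ℕ} {C₀ c₂' α₀ : ℝ} {fam₁ : I → B7.OneStep} {fam₂ : J → B7.KStep}

/-- First clause of `c₂ = min{1/(3C₀), ½c₂′}`: `C₀α₀ ≤ ⅓` (the form used by `B7.ineq53_induction`, hypothesis `hα3`).
[cite: Balaban1985Averaging, (54) p.26] -/
theorem Hyp.C₀_mul_α₀_le (h : Hyp L C₀ c₂' α₀ fam₁ fam₂) : C₀ * α₀ ≤ 1 / 3 := by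
  have h1 : α₀ ≤ 1 / (3 * C₀) := h.α₀_le_c₂.trans (min_le_left _ _)
  have hC := h.C₀_pos
  rw [le_div_iff₀ (by positivity)] at h1
  linarith

/-- Second clause of `c₂`: `2α₀ ≤ c₂′` (the form used by `B7.ineq53_induction`, hypothesis `hα2`; p. 26 «we require that
2α₀ ≤ c₂′. Then for j < k, we can apply Proposition 1 to the configuration Ū_j»). [cite: Balaban1985Averaging, (53)–(54) p.26] -/
theorem Hyp.two_mul_α₀_le (h : Hyp L C₀ c₂' α₀ fam₁ fam₂) : 2 * α₀ ≤ c₂' := by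
  have h1 : α₀ ≤ c₂' / 2 := h.α₀_le_c₂.trans (min_le_right _ _)
  linarith

/-- The last inequality of (54), «`α₀ + 2C₀α₀² < 2α₀`», at the standing `α₀` (`B7.prop2_bound_lt_two_alpha` BY NAME).
[cite: Balaban1985Averaging, (54) p.26] -/
theorem Hyp.bound54_lt (h : Hyp L C₀ c₂' α₀ fam₁ fam₂) : α₀ + 2 * C₀ * α₀ ^ 2 < 2 * α₀ :=
  B7.prop2_bound_lt_two_alpha C₀ α₀ h.α₀_pos h.C₀_mul_α₀_le

/-- (54) at the standing `α₀`: a configuration satisfying (52) («|U(∂p) − 1| < α₀η²», `plaqDevEta U < α₀`) has all its `k`-fold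
averaged plaquette variables within `α₀ + 2C₀α₀²` of `1`. [cite: Balaban1985Averaging, Prop. 2 (54) p.26, p.34] -/
theorem Hyp.avgDevK_lt (h : Hyp L C₀ c₂' α₀ fam₁ fam₂) (j : J) (U : (fam₂ j).Cfg) (h52 : (fam₂ j).plaqDevEta U < α₀) :
    (fam₂ j).avgDevK U < α₀ + 2 * C₀ * α₀ ^ 2 :=
  h.prop2 j α₀ h.α₀_pos h.α₀_le_c₂ U h52

/-- (54), both inequalities: «`|Ū^k(∂p) − 1| < α₀ + 2C₀α₀² < 2α₀`». [cite: Balaban1985Averaging, Prop. 2 (54) p.26] -/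
theorem Hyp.avgDevK_lt_two_mul (h : Hyp L C₀ c₂' α₀ fam₁ fam₂) (j : J) (U : (fam₂ j).Cfg)
    (h52 : (fam₂ j).plaqDevEta U < α₀) : (fam₂ j).avgDevK U < 2 * α₀ :=
  (h.avgDevK_lt j U h52).trans h.bound54_lt

/-- p. 26, after Proposition 1: «Each averaging operation rescales a bound on plaquette variables approximately by the factor L²,
hence k operations by the factor L^{2k}» — MADE EXACT from Proposition 1: for every `ε > 0` there is a threshold `a > 0` (namely
`min{c₂′, ε/(C₀L²)}` for the witnesses `C₀, c₂′` of `prop1`) such that `|V(∂p) − 1| < α ≤ a` on `Δ(p′)` gives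
`|V̄(∂p′) − 1| < (1 + ε)L²α`. [cite: Balaban1985Averaging, p.26, Prop. 1 (51) p.26] -/
theorem Hyp.rescales_by_L_sq (h : Hyp L C₀ c₂' α₀ fam₁ fam₂) {ε : ℝ} (hε : 0 < ε) :
    ∃ a : ℝ, 0 < a ∧ ∀ (i : I) (α : ℝ), 0 < α → α ≤ a → ∀ V : (fam₁ i).Cfg,
      (fam₁ i).plaqDev V < α → (fam₁ i).avgDev V < (1 + ε) * (L : ℝ) ^ 2 * α := by
  obtain ⟨C, c, hC, hc, hP⟩ := h.prop1
  rcases Nat.eq_zero_or_pos L with hL | hL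
  · -- degenerate block length `L = 0`: Proposition 1 reads `avgDev V < 0`
    refine ⟨c, hc, fun i α hα hαc V hV => ?_⟩
    have := hP i α hα hαc V hV
    subst hL
    simp only [CharP.cast_eq_zero, ne_eq, OfNat.ofNat_ne_zero, not_false_eq_true, zero_pow, zero_mul, mul_zero,
      add_zero] at this ⊢
    exact this
  · have hL2 : (0 : ℝ) < (L : ℝ) ^ 2 := by positivity
    refine ⟨min c (ε / (C * (L : ℝ) ^ 2)), lt_min hc (by positivity), fun i α hα hαa V hV => ?_⟩
    have hαc : α ≤ c := hαa.trans (min_le_left _ _)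
    have hαe : α ≤ ε / (C * (L : ℝ) ^ 2) := hαa.trans (min_le_right _ _)
    have key := hP i α hα hαc V hV
    -- `C (L²α)² = (C L² α)·(L² α) ≤ ε · L² α`
    have hCα : C * (L : ℝ) ^ 2 * α ≤ ε := by
      rw [le_div_iff₀ (by positivity)] at hαe
      linarith
    have hquad : C * ((L : ℝ) ^ 2 * α) ^ 2 ≤ ε * ((L : ℝ) ^ 2 * α) := by
      have h0 : 0 ≤ (L : ℝ) ^ 2 * α := by positivity
      calc C * ((L : ℝ) ^ 2 * α) ^ 2 = (C * (L : ℝ) ^ 2 * α) * ((L : ℝ) ^ 2 * α) := by ring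
        _ ≤ ε * ((L : ℝ) ^ 2 * α) := mul_le_mul_of_nonneg_right hCα h0
    calc (fam₁ i).avgDev V < (L : ℝ) ^ 2 * α + C * ((L : ℝ) ^ 2 * α) ^ 2 := key
      _ ≤ (L : ℝ) ^ 2 * α + ε * ((L : ℝ) ^ 2 * α) := by linarith
      _ = (1 + ε) * (L : ℝ) ^ 2 * α := by ring

end Consequences

/-! ### The discharge: the bundle HOLDS for the tree's concrete local averages on `ℤ^d` -/

section Discharge

variable {𝔸 : Type} [NormedRing 𝔸] [NormOneClass 𝔸] [NormedAlgebra ℂ 𝔸] [CompleteSpace 𝔸]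

/-- **THE BUNDLE IS A THEOREM FOR THE CONCRETE AVERAGES.**  For the block average (42)/(43) on `ℤ^d` with values in an
`AvgClosed` gauge group `G ⊂ {|u| ≤ 1, |u⁻¹| ≤ 1}` of a complete normed `ℂ`-algebra (`B7Prop1Local.concreteOneStepLocal`: index =
the big plaquettes `p′`, hypothesis (44) ONLY on `Δ(p′)`; `concreteKStepLocal`: index = all plaquettes of all `Ω^{(k)}`, hypothesis
(52) ONLY on the four `k`-blocks at the corners), `L ≥ 2`, the printed constants `C₀ = C0 d = 14464(d+1)²(d+4)²`,
`c₂′ = c2' d L = 1/(512(d+1)(d+4)L²)`, and EVERY standing `0 < α₀ ≤ c₂`, all six fields hold in the kernel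
(`prop1Printed_concrete_local`, `C0_pos`, `c2'_pos`, `prop2Printed_concrete_local` BY NAME). [cite: Balaban1985Averaging, Prop. 1 (51) p.26, Prop. 2 (54) p.26, p.34] -/
theorem Hyp.concreteLocal (d L : ℕ) (hL : 2 ≤ L) {G : Subgroup 𝔸ˣ} (hG : AvgClosed d L G) {α₀ : ℝ} (hα₀ : 0 < α₀)
    (hα : α₀ ≤ min (1 / (3 * C0 d)) (c2' d L / 2)) :
    Hyp L (C0 d) (c2' d L) α₀ (concreteOneStepLocal 𝔸 (d := d) L) (concreteKStepLocal d 𝔸 G L) where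
  prop1 := prop1Printed_concrete_local L (le_trans (by norm_num) hL)
  C₀_pos := C0_pos d
  c₂'_pos := c2'_pos d L (le_trans (by norm_num) hL)
  prop2 := prop2Printed_concrete_local L hL hG
  α₀_pos := hα₀
  α₀_le_c₂ := hα

/-- The standing smallness is satisfiable: `c₂ = min{1/(3C₀), ½c₂′} > 0` for the printed constants, so `α₀ := c₂` itself is an
admissible standing parameter (non-vacuity of `Hyp.concreteLocal`). [cite: Balaban1985Averaging, (54) p.26] -/
theorem c₂_pos (d L : ℕ) (hL : 1 ≤ L) : 0 < min (1 / (3 * C0 d)) (c2' d L / 2) :=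
  lt_min (by have := C0_pos d; positivity) (by have := c2'_pos d L hL; positivity)

end Discharge

section Matrices

open scoped Matrix.Norms.L2Operator

/-- **THE BUNDLE IN THE PAPER'S SETTING `G = U(N)`** (p. 20 «a Lie subgroup G of a unitary group U(N)», here `G = U(N)` itself,
`N ≥ 1`): configurations on `ℤ^d` with values in `U(N) ⊂ M_N(ℂ)` with the operator norm (19), the block averages (42)/(43) with
the printed localities, `L ≥ 2`, `C₀ = C0 d`, `c₂′ = c2' d L`, every `0 < α₀ ≤ c₂` (`B7Prop2Explicit.avgClosed_unitaryUnits` BY NAME).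
[cite: Balaban1985Averaging, Prop. 1 (51) p.26, Prop. 2 (54) p.26, p.20, p.34] -/
theorem Hyp.unitaryGroup (d N : ℕ) [NeZero N] (L : ℕ) (hL : 2 ≤ L) {α₀ : ℝ} (hα₀ : 0 < α₀)
    (hα : α₀ ≤ min (1 / (3 * C0 d)) (c2' d L / 2)) :
    Hyp L (C0 d) (c2' d L) α₀ (concreteOneStepLocal (Matrix (Fin N) (Fin N) ℂ) (d := d) L)
      (concreteKStepLocal d (Matrix (Fin N) (Fin N) ℂ) (unitaryUnits (Matrix (Fin N) (Fin N) ℂ)) L) := by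
  letI : CStarAlgebra (Matrix (Fin N) (Fin N) ℂ) := {}
  exact Hyp.concreteLocal d L hL (avgClosed_unitaryUnits d L) hα₀ hα

end Matrices

end Literature.MathematicalPhysics.QuantumFieldTheory.Balaban1983to89.B7Carve47SectsACHyp

end
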